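import Literature.Geometry.Lorentzian.KerrSchild
import Literature.Geometry.Lorentzian.BoostedKerrDilation
import HarnessLib

/-!
# `KerrFamilyScaling`: exact dilation covariance of the Kerr–Schild family
(crux `GapExhaustion`, stmt-FinalStateConjecture-10808, line photon-shell-pseudoconvexity;
registered stub `stub_kerrFamilyScaling` of the scale-covariant far sweep, lead c12 wave 1)

The far step of the outward sweep of a Killing field through the Kerr–Schild cylinders `{r = c}`
of an eternal near-Kerr chart works with ONE closeness tolerance at all radii; to reach
arbitrarily large radii it is made scale-covariant, and the exact input is the homogeneity of the
Kerr–Schild family under the dilation `z ↦ μ z` with `(M, a) ↦ (M/μ, a/μ)`: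

* the Kerr–Schild radius (the nonnegative root of `r⁴ − (‖x⃗‖² − a²) r² − a² x₃² = 0`,
  Visser arXiv:0706.0622, (35)) is homogeneous of degree one, `r_a(μ z) = μ · r_{a/μ}(z)`;
* the metric `g_{M,a} = η + 2H ℓ ⊗ ℓ` (Kerr–Schild 1965, §2) satisfies
  `g_{M,a}(μ z) = g_{M/μ, a/μ}(z)` as bilinear forms on `ℝ⁴`, since `H = M r³/(r⁴ + a² z₃²)` and
  `ℓ = (1, (r x + a y)/(r² + a²), (r y − a x)/(r² + a²), z/r)` are homogeneous of degree zero in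
  `(M, a, x) ↦ (μM, μa, μx)`.

Both identities hold for every `z : E4` (all junk branches — division by zero, square root of a
negative number — are themselves dilation consistent). They are the tree's `Kerr.radius_smul`
(`KerrConvergenceProofs.lean`) and `Kerr.bilin_smul_smul` (`BoostedKerrDilation.lean`), read at the
parameters `(M/μ, a/μ)`; this file is the two-line corollary in the registered form.

## References

* R. P. Kerr, A. Schild, *A new class of vacuum solutions of the Einstein field equations* (1965),
  §2. [KerrSchild1965]
* M. Visser, *The Kerr spacetime: a brief introduction*, arXiv:0706.0622, (32)–(35). [arXiv07060622]
-/

noncomputable section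

-- D-0017: single-problem summit, `Summit.<S>.<S>.…` by design (cf. lakefile `weak.linter.dupNamespace`).
set_option linter.dupNamespace false

namespace Summit.FinalStateConjecture.FinalStateConjecture.Theorems

open Literature.Geometry.Lorentzian

/-- **Exact dilation covariance of the Kerr–Schild family** (registered stub
`stub_kerrFamilyScaling` of line photon-shell-pseudoconvexity, crux `GapExhaustion`; input of the
scale-covariant far sweep): for `μ > 0` and every `z : ℝ⁴`,
`r_a(μ z) = μ · r_{a/μ}(z)` and `g_{M,a}(μ z) = g_{M/μ, a/μ}(z)` as bilinear forms on `ℝ⁴`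
(Kerr–Schild 1965, §2: `H` and `ℓ` are homogeneous of degree zero, `r` of degree one, under
`(M, a, x) ↦ (μM, μa, μx)`; Visser arXiv:0706.0622, (32)–(35)). [cite: KerrSchild1965, §2] -/
theorem stub_kerrFamilyScaling : ∀ (M a μ : ℝ), 0 < μ → ∀ z : E4, Kerr.radius a (μ • z) = μ * Kerr.radius (a / μ) z ∧ Kerr.bilin M a (μ • z) = Kerr.bilin (M / μ) (a / μ) z := by
  intro M a μ hμ z
  have ha : μ * (a / μ) = a := mul_div_cancel₀ a hμ.ne'
  have hM : μ * (M / μ) = M := mul_div_cancel₀ M hμ.ne'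
  refine ⟨?_, ?_⟩
  · rw [← Kerr.radius_smul hμ (a / μ) z, ha]
  · rw [← Kerr.bilin_smul_smul hμ (M / μ) (a / μ) z, hM, ha]

end Summit.FinalStateConjecture.FinalStateConjecture.Theorems

end
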